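import Summits.CriticalPhenomena.PercolationContinuityZ3.Theorems.Transplant.HeisenbergKSlab
import HarnessLib

/-!
# Connectivity of the `a_j`-slabs of `Cay(H_{2k+1}(ℤ))` (`k ≥ 2`) and of the whole Cayley graph

builds on p205010 (kernel theorem, internal audit signed; external expert review pending) — nothing in this file uses p205010.
Lane `prim-bschramm`, seat `prim-bschramm-p4` (gen 4; class map, memo `P4-GENERAL.md` §12), helper file
(`--supports stmt-CriticalPhenomena-4575`).  Fourth file of the `HeisenbergK*` series.

`G[Σ]`, `Σ = {|a_j| ≤ L}`, is connected as soon as there is a second generator pair `j' ≠ j` (every `L ≥ 0`): straight `A`-segments reach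
`(a, 0, 0)`, `B`-segments then reach some `(a, b, c₀)`, and the commutator 4-cycles `A_{j'} B_{j'} A_{j'}⁻¹ B_{j'}⁻¹ = C`,
`B_{j'} A_{j'} B_{j'}⁻¹ A_{j'}⁻¹ = C⁻¹` at the FREE pair `j'` (they never move `a_j`) adjust `c`.  Consequences: `hkSlabGraph_connected`,
`hkGraph_connected`. [cite: BenjaminiSchramm1996, §2 (Cayley graphs)] [cite: MartineauSevero2019, Cor. 2.2 (hypothesis: connected graph)]
-/

noncomputable section

namespace Summit.CriticalPhenomena.PercolationContinuityZ3.Theorems.Transplant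

open MeasureTheory Literature.Probability.Percolation Literature.Probability.LatticeModels SimpleGraph

variable {k : ℕ} {j : Fin k} {L : ℕ}

/-! ## §1 Steps, powers of generators -/

/-- A generator step that stays in the slab is an edge of the slab graph. [folklore] -/
theorem hkSlab_step {u : HK k} (hu : u ∈ hkSlab j L) {s : HK k} (hs : s ∈ hkGens k) (hv : hkMul u s ∈ hkSlab j L) :
    (hkSlabGraph j L).Reachable ⟨u, hu⟩ ⟨hkMul u s, hv⟩ := by
  refine SimpleGraph.Adj.reachable ?_
  rw [SimpleGraph.comap_adj, Function.Embedding.coe_subtype]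
  exact hkGraph_adj_mul_gen u hs

/-- Transport of a reachability target along an equality of vertices. [folklore] -/
theorem hkSlab_reach_of_eq {x : hkSlab j L} {v v' : HK k} {hv : v ∈ hkSlab j L} (h : v = v')
    (hr : (hkSlabGraph j L).Reachable x ⟨v, hv⟩) : (hkSlabGraph j L).Reachable x ⟨v', h ▸ hv⟩ := by
  subst h; exact hr

/-- `A_i^t = (t δ_i, 0, 0)`. [folklore] -/
def aPow (i : Fin k) (t : ℤ) : HK k := (Pi.single i t, 0, 0)

/-- `A_i^t A_i^{t'} = A_i^{t+t'}`. [folklore] -/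
theorem aPow_mul (i : Fin k) (t t' : ℤ) : hkMul (aPow i t) (aPow i t') = (aPow i (t + t') : HK k) := by
  refine Prod.ext (by simp [aPow, Pi.single_add]) (Prod.ext (by simp [aPow]) (by simp [aPow]))
/-- `A_i^0 = 1`. [folklore] -/
theorem aPow_zero (i : Fin k) : (aPow i 0 : HK k) = 0 := Prod.ext (Pi.single_zero i) rfl
/-- `A_i^1 = A_i`. [folklore] -/
theorem aPow_one (i : Fin k) : (aPow i 1 : HK k) = hkA i := rfl
/-- `A_i^{-1} = A_i⁻¹`. [folklore] -/
theorem aPow_neg_one (i : Fin k) : (aPow i (-1) : HK k) = hkAinv i :=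
  Prod.ext (Pi.single_neg (f := fun _ : Fin k => ℤ) i (1 : ℤ)) rfl
/-- `B_j^1 = B_j`. [folklore] -/
theorem bPow_one (i : Fin k) : (bPow i 1 : HK k) = hkB i := rfl
/-- `B_j^{-1} = B_j⁻¹`. [folklore] -/
theorem bPow_neg_one (i : Fin k) : (bPow i (-1) : HK k) = hkBinv i :=
  Prod.ext rfl (Prod.ext (Pi.single_neg (f := fun _ : Fin k => ℤ) i (1 : ℤ)) rfl)

/-- `A_i^{±1} ∈ S`. [folklore] -/
theorem aPow_mem_hkGens (i : Fin k) {σ : ℤ} (hσ : σ = 1 ∨ σ = -1) : (aPow i σ : HK k) ∈ hkGens k := by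
  rcases hσ with rfl | rfl
  · rw [aPow_one]; exact hkA_mem i
  · rw [aPow_neg_one]; exact hkAinv_mem i
/-- `B_i^{±1} ∈ S`. [folklore] -/
theorem bPow_mem_hkGens (i : Fin k) {σ : ℤ} (hσ : σ = 1 ∨ σ = -1) : (bPow i σ : HK k) ∈ hkGens k := by
  rcases hσ with rfl | rfl
  · rw [bPow_one]; exact hkB_mem i
  · rw [bPow_neg_one]; exact hkBinv_mem i

/-- Right multiplication by `A_i^t`: `(a,b,c) ↦ (a + tδ_i, b, c)`. [folklore] -/
theorem hkMul_aPow (x : HK k) (i : Fin k) (t : ℤ) : hkMul x (aPow i t) = (x.1 + Pi.single i t, x.2.1, x.2.2) := by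
  refine Prod.ext rfl (Prod.ext (by simp [aPow]) (by simp [aPow]))

/-- Right multiplication by `B_i^t`: `(a,b,c) ↦ (a, b + tδ_i, c + a_i t)`. [folklore] -/
theorem hkMul_bPow (x : HK k) (i : Fin k) (t : ℤ) : hkMul x (bPow i t) = (x.1, x.2.1 + Pi.single i t, x.2.2 + x.1 i * t) := by
  refine Prod.ext (by simp [bPow]) (Prod.ext rfl (by simp [bPow]))

/-! ## §2 Segments -/

/-- Betweenness for `A`-segments: if `u, u A_i^t ∈ Σ` then `u A_i^{t'} ∈ Σ` for `t'` between `0` and `t`. [folklore] -/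
theorem mem_hkSlab_between {u : HK k} (hu : u ∈ hkSlab j L) (i : Fin k) {t t' : ℤ}
    (hbt : (0 ≤ t' ∧ t' ≤ t) ∨ (t ≤ t' ∧ t' ≤ 0)) (ht : hkMul u (aPow i t) ∈ hkSlab j L) : hkMul u (aPow i t') ∈ hkSlab j L := by
  rw [mem_hkSlab_iff, hkMul_aPow] at ht ⊢
  have h0 := hu
  rw [mem_hkSlab_iff] at h0
  simp only [Pi.add_apply, Pi.single_apply] at ht ⊢
  by_cases hji : j = i
  · rw [if_pos hji] at ht ⊢
    rw [abs_le] at h0 ht ⊢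
    rcases hbt with ⟨h2, h3⟩ | ⟨h2, h3⟩ <;> constructor <;> linarith
  · rw [if_neg hji] at ht ⊢; exact ht

/-- **`A`-segments**: from `u ∈ Σ` to `u A_i^t ∈ Σ` inside the slab. [folklore] -/
theorem hkSlab_reach_aPow (u : HK k) (hu : u ∈ hkSlab j L) (i : Fin k) :
    ∀ (t : ℤ) (ht : hkMul u (aPow i t) ∈ hkSlab j L), (hkSlabGraph j L).Reachable ⟨u, hu⟩ ⟨hkMul u (aPow i t), ht⟩ := by
  intro t
  induction t using Int.induction_on with
  | zero =>
    intro ht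
    exact hkSlab_reach_of_eq (by rw [aPow_zero, hkMul_zero]) (Reachable.refl _)
  | succ n ih =>
    intro ht
    have hn : hkMul u (aPow i (n : ℤ)) ∈ hkSlab j L := mem_hkSlab_between hu i (Or.inl ⟨by positivity, by linarith⟩) ht
    have e : hkMul (hkMul u (aPow i (n : ℤ))) (aPow i 1) = hkMul u (aPow i ((n : ℤ) + 1)) := by rw [hkMul_assoc, aPow_mul]
    exact (ih hn).trans (hkSlab_reach_of_eq e (hkSlab_step hn (aPow_mem_hkGens i (Or.inl rfl)) (e ▸ ht)))
  | pred n ih =>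
    intro ht
    have hn : hkMul u (aPow i (-(n : ℤ))) ∈ hkSlab j L := mem_hkSlab_between hu i (Or.inr ⟨by linarith, by simp⟩) ht
    have e : hkMul (hkMul u (aPow i (-(n : ℤ)))) (aPow i (-1)) = hkMul u (aPow i (-(n : ℤ) - 1)) := by
      rw [hkMul_assoc, aPow_mul, sub_eq_add_neg]
    exact (ih hn).trans (hkSlab_reach_of_eq e (hkSlab_step hn (aPow_mem_hkGens i (Or.inr rfl)) (e ▸ ht)))

/-- `B`-steps never leave the slab. [folklore] -/
theorem hkMul_bPow_mem {u : HK k} (hu : u ∈ hkSlab j L) (i : Fin k) (t : ℤ) : hkMul u (bPow i t) ∈ hkSlab j L := by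
  rw [mem_hkSlab_iff, hkMul_bPow]; exact hu

/-- **`B`-segments**: from `u ∈ Σ` to `u B_i^t` inside the slab (always possible). [folklore] -/
theorem hkSlab_reach_bPow (u : HK k) (hu : u ∈ hkSlab j L) (i : Fin k) (t : ℤ) :
    (hkSlabGraph j L).Reachable ⟨u, hu⟩ ⟨hkMul u (bPow i t), hkMul_bPow_mem hu i t⟩ := by
  induction t using Int.induction_on with
  | zero => exact hkSlab_reach_of_eq (by rw [bPow_zero, hkMul_zero]) (Reachable.refl _)
  | succ n ih =>
    have e : hkMul (hkMul u (bPow i (n : ℤ))) (bPow i 1) = hkMul u (bPow i ((n : ℤ) + 1)) := by rw [hkMul_assoc, bPow_mul]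
    exact ih.trans (hkSlab_reach_of_eq e (hkSlab_step (hkMul_bPow_mem hu i _) (bPow_mem_hkGens i (Or.inl rfl))
      (e ▸ hkMul_bPow_mem hu i _)))
  | pred n ih =>
    have e : hkMul (hkMul u (bPow i (-(n : ℤ)))) (bPow i (-1)) = hkMul u (bPow i (-(n : ℤ) - 1)) := by
      rw [hkMul_assoc, bPow_mul, sub_eq_add_neg]
    exact ih.trans (hkSlab_reach_of_eq e (hkSlab_step (hkMul_bPow_mem hu i _) (bPow_mem_hkGens i (Or.inr rfl))
      (e ▸ hkMul_bPow_mem hu i _)))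

/-- **`(a, 0, 0)` is reachable from `1` inside the slab for every admissible `a`** (one coordinate at a time). [folklore] -/
theorem hkSlab_reach_a (S : Finset (Fin k)) : ∀ a : Fin k → ℤ, (∀ i, i ∉ S → a i = 0) → ∀ (ha : |a j| ≤ L),
    (hkSlabGraph j L).Reachable (hkSlabOrigin j L) ⟨(a, 0, 0), ha⟩ := by
  classical
  induction S using Finset.induction_on with
  | empty =>
    intro a hS ha
    have : a = 0 := funext fun i => hS i (Finset.notMem_empty i)
    subst this
    exact hkSlab_reach_of_eq (by rfl) (Reachable.refl _)
  | insert i S hi ih =>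
    intro a hS ha
    have ha' : |Function.update a i 0 j| ≤ L := by
      by_cases hji : j = i
      · rw [hji, Function.update_self]; simp
      · rw [Function.update_of_ne hji]; exact ha
    have r := ih (Function.update a i 0) (fun l hl => by
      by_cases hli : l = i
      · subst hli; simp
      · rw [Function.update_of_ne hli]; exact hS l (by simp [hli, hl])) ha'
    have e : hkMul ((Function.update a i 0, 0, 0) : HK k) (aPow i (a i)) = (a, 0, 0) := by
      rw [hkMul_aPow]
      refine Prod.ext (funext fun l => ?_) rfl
      simp only [Pi.add_apply, Pi.single_apply]
      by_cases hli : l = i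
      · subst hli; simp
      · rw [if_neg hli, add_zero, Function.update_of_ne hli]
    have hmem : hkMul ((Function.update a i 0, 0, 0) : HK k) (aPow i (a i)) ∈ hkSlab j L := by rw [e]; exact ha
    exact hkSlab_reach_of_eq e (r.trans (hkSlab_reach_aPow _ ha' i (a i) hmem))

/-- **Some `(a, b, c₀)` is reachable from `(a, 0, 0)` inside the slab for every `b`.** [folklore] -/
theorem hkSlab_reach_b (a : Fin k → ℤ) (ha : |a j| ≤ L) (S : Finset (Fin k)) : ∀ b : Fin k → ℤ, (∀ i, i ∉ S → b i = 0) →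
    ∃ c : ℤ, (hkSlabGraph j L).Reachable ⟨(a, 0, 0), ha⟩ ⟨(a, b, c), ha⟩ := by
  classical
  induction S using Finset.induction_on with
  | empty =>
    intro b hS
    have : b = 0 := funext fun i => hS i (Finset.notMem_empty i)
    subst this
    exact ⟨0, Reachable.refl _⟩
  | insert i S hi ih =>
    intro b hS
    obtain ⟨c', r⟩ := ih (Function.update b i 0) (fun l hl => by
      by_cases hli : l = i
      · subst hli; simp
      · rw [Function.update_of_ne hli]; exact hS l (by simp [hli, hl]))
    have e : hkMul ((a, Function.update b i 0, c') : HK k) (bPow i (b i)) = (a, b, c' + a i * b i) := by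
      rw [hkMul_bPow]
      refine Prod.ext rfl (Prod.ext (funext fun l => ?_) rfl)
      simp only [Pi.add_apply, Pi.single_apply]
      by_cases hli : l = i
      · subst hli; simp
      · rw [if_neg hli, add_zero, Function.update_of_ne hli]
    exact ⟨c' + a i * b i, hkSlab_reach_of_eq e (r.trans (hkSlab_reach_bPow _ ha i (b i)))⟩

/-! ## §3 Commutator cycles at a free pair `j' ≠ j` adjust `c` -/

section Free

variable {j' : Fin k} (hjj : j' ≠ j)
include hjj

/-- `A_{j'}`-steps never leave the `a_j`-slab (`j' ≠ j`). [folklore] -/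
theorem hkMul_aPow_mem_of_ne {u : HK k} (hu : u ∈ hkSlab j L) (t : ℤ) : hkMul u (aPow j' t) ∈ hkSlab j L := by
  rw [mem_hkSlab_iff, hkMul_aPow]
  simp only [Pi.add_apply, Pi.single_eq_of_ne hjj.symm, add_zero]
  exact hu

/-- **`c ↦ c + 1`**: the cycle `A_{j'} B_{j'} A_{j'}⁻¹ B_{j'}⁻¹` from `(a,b,c)` ends at `(a,b,c+1)`, inside the slab. [folklore] -/
theorem hkSlab_reach_c_succ (a b : Fin k → ℤ) (c : ℤ) (ha : |a j| ≤ L) :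
    (hkSlabGraph j L).Reachable ⟨(a, b, c), ha⟩ ⟨(a, b, c + 1), ha⟩ := by
  have hu : ((a, b, c) : HK k) ∈ hkSlab j L := ha
  have m1 := hkMul_aPow_mem_of_ne hjj hu 1
  have m2 := hkMul_bPow_mem m1 j' 1
  have m3 := hkMul_aPow_mem_of_ne hjj m2 (-1)
  have m4 := hkMul_bPow_mem m3 j' (-1)
  have e : hkMul (hkMul (hkMul (hkMul ((a, b, c) : HK k) (aPow j' 1)) (bPow j' 1)) (aPow j' (-1))) (bPow j' (-1)) = (a, b, c + 1) := by
    simp only [hkMul_aPow, hkMul_bPow, Pi.add_apply, Pi.single_eq_same]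
    refine Prod.ext ?_ (Prod.ext ?_ ?_)
    · funext l; simp only [Pi.add_apply, Pi.single_apply]; split_ifs <;> ring
    · funext l; simp only [Pi.add_apply, Pi.single_apply]; split_ifs <;> ring
    · ring
  exact hkSlab_reach_of_eq e ((((hkSlab_step hu (aPow_mem_hkGens j' (Or.inl rfl)) m1).trans
    (hkSlab_step m1 (bPow_mem_hkGens j' (Or.inl rfl)) m2)).trans (hkSlab_step m2 (aPow_mem_hkGens j' (Or.inr rfl)) m3)).trans
    (hkSlab_step m3 (bPow_mem_hkGens j' (Or.inr rfl)) m4))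

/-- **`c ↦ c − 1`**: the cycle `B_{j'} A_{j'} B_{j'}⁻¹ A_{j'}⁻¹`. [folklore] -/
theorem hkSlab_reach_c_pred (a b : Fin k → ℤ) (c : ℤ) (ha : |a j| ≤ L) :
    (hkSlabGraph j L).Reachable ⟨(a, b, c), ha⟩ ⟨(a, b, c - 1), ha⟩ := by
  have hu : ((a, b, c) : HK k) ∈ hkSlab j L := ha
  have m1 := hkMul_bPow_mem hu j' 1
  have m2 := hkMul_aPow_mem_of_ne hjj m1 1
  have m3 := hkMul_bPow_mem m2 j' (-1)
  have m4 := hkMul_aPow_mem_of_ne hjj m3 (-1)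
  have e : hkMul (hkMul (hkMul (hkMul ((a, b, c) : HK k) (bPow j' 1)) (aPow j' 1)) (bPow j' (-1))) (aPow j' (-1)) = (a, b, c - 1) := by
    simp only [hkMul_aPow, hkMul_bPow, Pi.add_apply, Pi.single_eq_same]
    refine Prod.ext ?_ (Prod.ext ?_ ?_)
    · funext l; simp only [Pi.add_apply, Pi.single_apply]; split_ifs <;> ring
    · funext l; simp only [Pi.add_apply, Pi.single_apply]; split_ifs <;> ring
    · ring
  exact hkSlab_reach_of_eq e ((((hkSlab_step hu (bPow_mem_hkGens j' (Or.inl rfl)) m1).trans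
    (hkSlab_step m1 (aPow_mem_hkGens j' (Or.inl rfl)) m2)).trans (hkSlab_step m2 (bPow_mem_hkGens j' (Or.inr rfl)) m3)).trans
    (hkSlab_step m3 (aPow_mem_hkGens j' (Or.inr rfl)) m4))

/-- **Any two points of the slab over the same `(a, b)` are joined inside the slab.** [folklore] -/
theorem hkSlab_reach_c (a b : Fin k → ℤ) (ha : |a j| ≤ L) (c : ℤ) :
    ∀ d : ℤ, (hkSlabGraph j L).Reachable ⟨(a, b, c), ha⟩ ⟨(a, b, c + d), ha⟩ := by
  intro d
  induction d using Int.induction_on with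
  | zero => exact hkSlab_reach_of_eq (by simp) (Reachable.refl _)
  | succ n ih => exact ih.trans (hkSlab_reach_of_eq (by ring) (hkSlab_reach_c_succ hjj a b (c + n) ha))
  | pred n ih => exact ih.trans (hkSlab_reach_of_eq (by ring) (hkSlab_reach_c_pred hjj a b (c + -n) ha))

/-- **Every slab vertex is joined to `1` inside the slab.** [folklore] -/
theorem hkSlab_reach_all (x : hkSlab j L) : (hkSlabGraph j L).Reachable (hkSlabOrigin j L) x := by
  classical
  obtain ⟨⟨a, b, c⟩, hx⟩ := x
  have ha : |a j| ≤ L := hx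
  have r1 := hkSlab_reach_a (j := j) (L := L) Finset.univ a (fun i hi => absurd (Finset.mem_univ i) hi) ha
  obtain ⟨c₀, r2⟩ := hkSlab_reach_b (j := j) (L := L) a ha Finset.univ b (fun i hi => absurd (Finset.mem_univ i) hi)
  have r3 := hkSlab_reach_c hjj a b ha c₀ (c - c₀)
  exact (r1.trans r2).trans (hkSlab_reach_of_eq (by simp) r3)

/-- **The slab graph `G[Σ]` is connected** (`k ≥ 2`: a free pair `j' ≠ j` exists; every `L`). [cite: MartineauSevero2019, Cor. 2.2 (hypothesis)] -/
theorem hkSlabGraph_connected : (hkSlabGraph j L).Connected :=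
  { preconnected := fun x y => (hkSlab_reach_all hjj x).symm.trans (hkSlab_reach_all hjj y)
    nonempty := ⟨hkSlabOrigin j L⟩ }

/-- **`Cay(H_{2k+1}(ℤ))` is connected** (`k ≥ 2`; every vertex lies in the slab `{|a_j| ≤ |x.a_j|}`). [cite: BenjaminiSchramm1996, §2] -/
theorem hkGraph_connected : (hkGraph k).Connected := by
  refine { preconnected := fun x y => ?_, nonempty := ⟨0⟩ }
  have hx : x ∈ hkSlab j (x.1 j).natAbs := by rw [mem_hkSlab_iff, Int.natCast_natAbs]
  have hy : y ∈ hkSlab j (y.1 j).natAbs := by rw [mem_hkSlab_iff, Int.natCast_natAbs]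
  have rx := (hkSlab_reach_all (L := (x.1 j).natAbs) hjj ⟨x, hx⟩).map (Embedding.induce (hkSlab j (x.1 j).natAbs)).toHom
  have ry := (hkSlab_reach_all (L := (y.1 j).natAbs) hjj ⟨y, hy⟩).map (Embedding.induce (hkSlab j (y.1 j).natAbs)).toHom
  exact rx.symm.trans ry

end Free

end Summit.CriticalPhenomena.PercolationContinuityZ3.Theorems.Transplant

end
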